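import Summits.KontsevichZagierPeriods.KontsevichZagierPeriods.Theorems.CobordismMoveEllipsoidGaussMapCoV

/-!
# `Lines/EllipsoidGaussKronecker_special.lean` — F3 / BC5 compiled WITNESS for the rung line
`EllipsoidGaussKronecker` on crux `TopologicalMovesKernel` (stmt-KontsevichZagierPeriods-5565, route CobordismMove):
`Rung 2` IS the proved floor `CobordismMove.EllipsoidGaussMapCoV` (stmt-KontsevichZagierPeriods-5569, proved by
`Summit.KontsevichZagierPeriods.CobordismMove.ellipsoidGaussMapCoV_proof`), re-curried from `(A B : ℚ)` to
`(A : Fin 2 → ℚ)` by `Fin.sum_univ_two` / `Fin.prod_univ_two`. `lean check`: rc 0, 0 sorries.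
(The def `Rung` is copied verbatim from `Lines/EllipsoidGaussKronecker.lean`; this file deliberately does NOT import
the skeleton, so the witness stays sorry-free and independent of the stubs.)
FORWARD: generator=rung ; seed=g1-KontsevichZagierPeriods-5569 ; witness=`rung_two` below ;
rung_decl=Summit.KontsevichZagierPeriods.KontsevichZagierPeriods.Theses.GaussKroneckerLadder.EllipsoidGaussKroneckerCoV (= ∀ n, Rung n).
-/

noncomputable section

set_option linter.dupNamespace false

open MeasureTheory Set

namespace Summit.KontsevichZagierPeriods.KontsevichZagierPeriods.Theses.GaussKroneckerLadder

open Literature.NumberTheory.Transcendental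

/-- **The ladder** (verbatim copy of the line file's `Rung`). -/
def Rung (n : ℕ) : Prop :=
  ∀ (A : Fin n → ℚ) (C : ℚ), (∀ i, 0 < A i) → 0 < C →
    ∀ (r r' : KZ.IntegralRep n),
      r.domain = {p | ∑ i, (p i) ^ 2 / (A i : ℝ) < 1} →
      Set.EqOn r.integrand (fun p => 1 / ((∏ i, (A i : ℝ)) *
          Real.sqrt ((C : ℝ) * (1 - ∑ i, (p i) ^ 2 / (A i : ℝ))) *
          Real.sqrt (∑ i, (p i) ^ 2 / (A i : ℝ) ^ 2 +
            (1 - ∑ i, (p i) ^ 2 / (A i : ℝ)) / (C : ℝ)) ^ (n + 1))) r.domain →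
      r'.domain = {w | ∑ i, (w i) ^ 2 < 1} →
      Set.EqOn r'.integrand (fun w => 1 / Real.sqrt (1 - ∑ i, (w i) ^ 2)) r'.domain →
      KZ.of r - KZ.of r' ∈ KZ.changeOfVariablesRel

/-- **WITNESS (F3/BC5): the floor is `Rung 2`.** [folklore] -/
theorem rung_two : Rung 2 := by
  intro A C hA hC r r' hrd hri hr'd hr'i
  refine Summit.KontsevichZagierPeriods.CobordismMove.ellipsoidGaussMapCoV_proof (A 0) (A 1) C (hA 0) (hA 1) hC
    r r' ?_ ?_ ?_ ?_
  · simpa [Fin.sum_univ_two] using hrd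
  · simpa [Fin.sum_univ_two, Fin.prod_univ_two, sub_sub] using hri
  · simpa [Fin.sum_univ_two] using hr'd
  · simpa [Fin.sum_univ_two, sub_sub] using hr'i

example : Rung 2 := rung_two

end Summit.KontsevichZagierPeriods.KontsevichZagierPeriods.Theses.GaussKroneckerLadder

end
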